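import Summits.AtomisticToContinuum.FouriersLaw.Theorems.VanishingNoiseTransferNoiseLocalityStubResponseDensityNoisyAux2
import Summits.AtomisticToContinuum.FouriersLaw.Theorems.VanishingNoiseTransferNoiseLocalityStubResponseDensityDetAux1
import Summits.AtomisticToContinuum.FouriersLaw.Theorems.VanishingNoiseTransferNoiseLocalityStubResponseDensityNoisyAux1

/-!
# Response density of the flip-noisy steady family from an a priori `L²` bound and `L²`-uniqueness
of the linearised equation (helpers for stub `stub_responseDensityNoisy`), part B: the reduction

Helper file `--supports stmt-AtomisticToContinuum-11975` (crux `NoiseLocality`, route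
`VanishingNoiseTransfer`, line `relative-flip-energy-transfer`, stub 1b `stub_responseDensityNoisy`).

**Compactness + uniqueness.** Let `μ T_L T_R` be the weak steady family of the flip-noisy pinned
chain `L + εS` (any rate `ε`, any length `N`), unique at `(T, T)` (so `μ T T = μ_T`, the Gibbs
measure), and write `μ_δ = μ (T+δ/2) (T-δ/2)`. ASSUME

* (A) an A PRIORI LINEAR-RESPONSE BOUND IN `L²(μ_T)`: for small `δ ≠ 0` there is `k_δ` with
  `∫ k_δ² dμ_T ≤ C` representing the difference quotient of the family on `L²(μ_T)`,
  `∫ F dμ_δ = ∫ F dμ_T + δ ∫ F k_δ dμ_T` for every `F ∈ L²(μ_T)` (i.e. `dμ_δ/dμ_T = 1 + δ k_δ` with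
  `‖k_δ‖₂² ≤ C`);
* (U) `L²(μ_T)`-UNIQUENESS FOR THE LINEARISED EQUATION: a mean-zero `k ∈ L²(μ_T)` with
  `∫ (L_{T,T} f + εSf) k dμ_T = 0` for all `f ∈ C_c^∞` vanishes a.e. (`C_c^∞` is a core of the
  `L²(μ_T)`-generator of the flip-noisy equilibrium dynamics and `μ_T` is ergodic for it).

THEN (`of_apriori_of_unique`) the conclusion of the stub holds: there is `U ∈ L²(μ_T)` with
`d/dδ ∫ g dμ_δ |₀ = ∫ g U dμ_T` for every `g ∈ C_c^∞` and `d/dδ totalCurrent(μ_δ)|₀ = ∑_i ∫ j_i U dμ_T`.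
Proof: the steady-state equations `∫ (L_δ + εS) f dμ_δ = 0`, `∫ (L_0 + εS) f dμ_T = 0` and
`L_δ = L_0 + δ V` (`flipGenerator_temp_split`) give `⟨k_δ, (L_0+εS) f⟩ = -∫ Vf dμ_T - δ⟨k_δ, Vf⟩ →
-∫ V f dμ_T`, and `⟨k_δ, 1⟩ = 0`; by (U) these moment equations have at most one solution in
`L²(μ_T)`, so the bounded net `k_δ` converges weakly (`exists_tendsto_inner_of_norm_le`,
Banach–Alaoglu) to some `U`; testing against `g ∈ C_c^∞ ⊂ L²` and the bond currents `j_i ∈ L²(μ_T)`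
(`memLp_bondCurrent_gibbsMeasure`) gives the difference-quotient limits, and
`StubResponseDensityDet.of_tendsto_slope` the `HasDerivAt` form. So the stub for `N ≥ 2` is reduced
to the two named analytic inputs (A) and (U). No definitions.
-/

noncomputable section

open MeasureTheory Filter Topology
open scoped ContDiff InnerProductSpace

namespace Summit.AtomisticToContinuum.FouriersLaw.Theorems.NoiseLocality.StubResponseDensityNoisy

open Literature.MathematicalPhysics.KineticTheory.HeatConduction

/-- **The stub's conclusion from (A) an a priori `L²(μ_T)` linear-response bound and (U)
`L²(μ_T)`-uniqueness of the linearised flip-noisy equation** (pinned chain `ω₂ > 0`, `lam, β ≥ 0`,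
any `γ`, any length `N`, any rate `ε`, `T > 0`; the family is only used through its steadiness at
positive temperatures and its uniqueness at `(T, T)`). See the module docstring for the proof. -/
theorem of_apriori_of_unique {ω₂ lam β : ℝ} (hω : 0 < ω₂) (hl : 0 ≤ lam) (hβ : 0 ≤ β) (γ : ℝ)
    (N : ℕ) {T : ℝ} (hT : 0 < T) (ε : ℝ) (μ : ℝ → ℝ → Measure (PhaseSpace N))
    (hμ : ∀ T_L T_R : ℝ, 0 < T_L → 0 < T_R →
      (pinnedChain ω₂ lam β γ).IsFlipSteadyState N T_L T_R ε (μ T_L T_R) ∧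
        ∀ ν : Measure (PhaseSpace N),
          (pinnedChain ω₂ lam β γ).IsFlipSteadyState N T_L T_R ε ν → ν = μ T_L T_R)
    (hA : ∃ C : ℝ, ∀ᶠ δ in 𝓝[≠] (0 : ℝ), ∃ k : PhaseSpace N → ℝ,
      MemLp k 2 ((pinnedChain ω₂ lam β γ).gibbsMeasure N T) ∧
        ∫ x, k x ^ 2 ∂((pinnedChain ω₂ lam β γ).gibbsMeasure N T) ≤ C ∧
        ∀ F : PhaseSpace N → ℝ, MemLp F 2 ((pinnedChain ω₂ lam β γ).gibbsMeasure N T) →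
          Integrable F (μ (T + δ / 2) (T - δ / 2)) ∧
            ∫ x, F x ∂(μ (T + δ / 2) (T - δ / 2)) =
              ∫ x, F x ∂((pinnedChain ω₂ lam β γ).gibbsMeasure N T) +
                δ * ∫ x, F x * k x ∂((pinnedChain ω₂ lam β γ).gibbsMeasure N T))
    (hU : ∀ k : PhaseSpace N → ℝ, MemLp k 2 ((pinnedChain ω₂ lam β γ).gibbsMeasure N T) →
      ∫ x, k x ∂((pinnedChain ω₂ lam β γ).gibbsMeasure N T) = 0 →
        (∀ f : PhaseSpace N → ℝ, ContDiff ℝ ∞ f → HasCompactSupport f →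
          ∫ x, (pinnedChain ω₂ lam β γ).flipGenerator N T T ε f x * k x
            ∂((pinnedChain ω₂ lam β γ).gibbsMeasure N T) = 0) →
        k =ᵐ[(pinnedChain ω₂ lam β γ).gibbsMeasure N T] 0) :
    ∃ U : PhaseSpace N → ℝ,
      MemLp U 2 ((pinnedChain ω₂ lam β γ).gibbsMeasure N T) ∧
        (∀ g : PhaseSpace N → ℝ, ContDiff ℝ ((⊤ : ℕ∞) : WithTop ℕ∞) g → HasCompactSupport g →
            HasDerivAt (fun δ : ℝ => ∫ x, g x ∂(μ (T + δ / 2) (T - δ / 2)))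
              (∫ x, g x * U x ∂((pinnedChain ω₂ lam β γ).gibbsMeasure N T)) 0) ∧
        HasDerivAt (fun δ : ℝ => (pinnedChain ω₂ lam β γ).totalCurrent (μ (T + δ / 2) (T - δ / 2)))
          (∑ i : Fin N, ∫ x, (pinnedChain ω₂ lam β γ).bondCurrent N i x * U x
            ∂((pinnedChain ω₂ lam β γ).gibbsMeasure N T)) 0 := by
  classical
  set P := pinnedChain ω₂ lam β γ with hP
  set π := P.gibbsMeasure N T with hπ_def
  -- basic facts about `π`
  have hπμ : μ T T = π := flipSteadyFamily_eq_gibbsMeasure hω hl hβ γ hT ε μ hμ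
  haveI hprob : IsProbabilityMeasure π := pinnedChain_isProbabilityMeasure_gibbsMeasure hω hl hβ γ N hT
  have hπst : P.IsFlipSteadyState N T T ε π := pinnedChain_isFlipSteadyState_gibbsMeasure hω hl hβ γ N hT ε
  -- the temperature derivative of the generator
  set V : (PhaseSpace N → ℝ) → PhaseSpace N → ℝ := fun f x => P.γ * ∑ i : Fin N,
    ((if i.val = 0 then 1 / 2 * partialP i (partialP i f) x else 0) +
      (if i.val = N - 1 then -(1 / 2) * partialP i (partialP i f) x else 0)) with hV_def
  -- (A): choose the difference quotients `k δ`
  obtain ⟨C, hC⟩ := hA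
  have hC' : ∀ δ : ℝ, ∃ k : PhaseSpace N → ℝ, MemLp k 2 π ∧
      ((∃ k' : PhaseSpace N → ℝ, MemLp k' 2 π ∧ ∫ x, k' x ^ 2 ∂π ≤ C ∧
        ∀ F : PhaseSpace N → ℝ, MemLp F 2 π → Integrable F (μ (T + δ / 2) (T - δ / 2)) ∧
          ∫ x, F x ∂(μ (T + δ / 2) (T - δ / 2)) = ∫ x, F x ∂π + δ * ∫ x, F x * k' x ∂π) →
      (∫ x, k x ^ 2 ∂π ≤ C ∧
        ∀ F : PhaseSpace N → ℝ, MemLp F 2 π → Integrable F (μ (T + δ / 2) (T - δ / 2)) ∧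
          ∫ x, F x ∂(μ (T + δ / 2) (T - δ / 2)) = ∫ x, F x ∂π + δ * ∫ x, F x * k x ∂π)) := by
    intro δ
    by_cases h : ∃ k' : PhaseSpace N → ℝ, MemLp k' 2 π ∧ ∫ x, k' x ^ 2 ∂π ≤ C ∧
        ∀ F : PhaseSpace N → ℝ, MemLp F 2 π → Integrable F (μ (T + δ / 2) (T - δ / 2)) ∧
          ∫ x, F x ∂(μ (T + δ / 2) (T - δ / 2)) = ∫ x, F x ∂π + δ * ∫ x, F x * k' x ∂π
    · obtain ⟨k', hk'⟩ := h
      exact ⟨k', hk'.1, fun _ => hk'.2⟩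
    · exact ⟨0, MemLp.zero, fun h' => absurd h' h⟩
  choose k hkmem hkQ using hC'
  -- the good parameters: `δ ≠ 0`, `|δ| < 2T`, and the representation holds for `k δ`
  have hev : ∀ᶠ δ in 𝓝[≠] (0 : ℝ), δ ≠ 0 ∧ (0 < T + δ / 2 ∧ 0 < T - δ / 2) ∧
      (∫ x, k δ x ^ 2 ∂π ≤ C ∧
        ∀ F : PhaseSpace N → ℝ, MemLp F 2 π → Integrable F (μ (T + δ / 2) (T - δ / 2)) ∧
          ∫ x, F x ∂(μ (T + δ / 2) (T - δ / 2)) = ∫ x, F x ∂π + δ * ∫ x, F x * k δ x ∂π) := by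
    have hball : ∀ᶠ δ in 𝓝 (0 : ℝ), |δ| < 2 * T := by
      have : Metric.ball (0 : ℝ) (2 * T) ∈ 𝓝 (0 : ℝ) := Metric.ball_mem_nhds 0 (by positivity)
      filter_upwards [this] with δ hδ
      simpa [Real.dist_eq] using hδ
    filter_upwards [self_mem_nhdsWithin, hball.filter_mono nhdsWithin_le_nhds, hC] with δ h1 h2 h3
    refine ⟨h1, ⟨?_, ?_⟩, hkQ δ h3⟩
    · have := neg_abs_le δ
      linarith
    · have := le_abs_self δ
      linarith
  -- the net in `L²(π)`
  set v : ℝ → Lp ℝ 2 π := fun δ => (hkmem δ).toLp (k δ) with hv_def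
  have hb : ∀ᶠ δ in 𝓝[≠] (0 : ℝ), ‖v δ‖ ≤ Real.sqrt C := by
    filter_upwards [hev] with δ ⟨_, _, hQ, _⟩
    exact norm_toLp_le_sqrt (hkmem δ) hQ
  have hv_inner : ∀ (δ : ℝ) {F : PhaseSpace N → ℝ} (hF : MemLp F 2 π),
      ⟪v δ, hF.toLp F⟫_ℝ = ∫ x, k δ x * F x ∂π := fun δ _ hF =>
    inner_toLp_toLp_eq_integral (hkmem δ) hF
  -- the test vectors and the moments
  have hLmem : ∀ f : {f : PhaseSpace N → ℝ // ContDiff ℝ ∞ f ∧ HasCompactSupport f},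
      MemLp (P.flipGenerator N T T ε f.1) 2 π := fun f =>
    memLp_flipGenerator ω₂ lam β γ N T T ε f.2.1 f.2.2 π 2
  have hVmem : ∀ f : {f : PhaseSpace N → ℝ // ContDiff ℝ ∞ f ∧ HasCompactSupport f},
      MemLp (V f.1) 2 π := fun f => memLp_tempDeriv P f.2.1 f.2.2 π 2
  have h1mem : MemLp (fun _ : PhaseSpace N => (1 : ℝ)) 2 π := memLp_const 1
  let e : Option {f : PhaseSpace N → ℝ // ContDiff ℝ ∞ f ∧ HasCompactSupport f} → Lp ℝ 2 π :=
    fun j => j.elim (h1mem.toLp _) fun f => (hLmem f).toLp _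
  let c : Option {f : PhaseSpace N → ℝ // ContDiff ℝ ∞ f ∧ HasCompactSupport f} → ℝ :=
    fun j => j.elim 0 fun f => -∫ x, V f.1 x ∂π
  -- moments against `(L + εS) f`
  have hmom : ∀ f : {f : PhaseSpace N → ℝ // ContDiff ℝ ∞ f ∧ HasCompactSupport f},
      Tendsto (fun δ => ⟪v δ, (hLmem f).toLp _⟫_ℝ) (𝓝[≠] 0) (𝓝 (-∫ x, V f.1 x ∂π)) := by
    intro f
    have hfs := f.2.1
    have hfc := f.2.2
    have hid : ∀ᶠ δ in 𝓝[≠] (0 : ℝ), ⟪v δ, (hLmem f).toLp _⟫_ℝ =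
        -∫ x, V f.1 x ∂π - δ * ⟪v δ, (hVmem f).toLp _⟫_ℝ := by
      filter_upwards [hev] with δ ⟨hne, ⟨h1, h2⟩, _, hrep⟩
      have hst : ∫ x, P.flipGenerator N (T + δ / 2) (T - δ / 2) ε f.1 x ∂(μ (T + δ / 2) (T - δ / 2)) = 0 :=
        (hμ _ _ h1 h2).1.2.1 f.1 hfs hfc
      obtain ⟨hiL, hL⟩ := hrep _ (hLmem f)
      obtain ⟨hiV, hV⟩ := hrep _ (hVmem f)
      have hπ0 : ∫ x, P.flipGenerator N T T ε f.1 x ∂π = 0 := hπst.2.1 f.1 hfs hfc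
      have hsplit : ∫ x, P.flipGenerator N (T + δ / 2) (T - δ / 2) ε f.1 x ∂(μ (T + δ / 2) (T - δ / 2)) =
          (∫ x, P.flipGenerator N T T ε f.1 x ∂(μ (T + δ / 2) (T - δ / 2))) +
            δ * ∫ x, V f.1 x ∂(μ (T + δ / 2) (T - δ / 2)) := by
        rw [← integral_const_mul, ← integral_add hiL (hiV.const_mul δ)]
        exact integral_congr_ae (Eventually.of_forall fun x => flipGenerator_temp_split P N T δ ε f.1 x)
      rw [hv_inner, hv_inner]
      have e1 : ∫ x, k δ x * P.flipGenerator N T T ε f.1 x ∂π =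
          ∫ x, P.flipGenerator N T T ε f.1 x * k δ x ∂π :=
        integral_congr_ae (Eventually.of_forall fun x => mul_comm _ _)
      have e2 : ∫ x, k δ x * V f.1 x ∂π = ∫ x, V f.1 x * k δ x ∂π :=
        integral_congr_ae (Eventually.of_forall fun x => mul_comm _ _)
      rw [e1, e2]
      rw [hsplit, hL, hV, hπ0] at hst
      have key : δ * ((∫ x, P.flipGenerator N T T ε f.1 x * k δ x ∂π) + ∫ x, V f.1 x ∂π +
          δ * ∫ x, V f.1 x * k δ x ∂π) = 0 := by
        linear_combination hst
      rcases mul_eq_zero.1 key with h | h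
      · exact absurd h hne
      · linarith
    have hsmall : Tendsto (fun δ : ℝ => δ * ⟪v δ, (hVmem f).toLp _⟫_ℝ) (𝓝[≠] 0) (𝓝 0) := by
      have hbd : ∀ᶠ δ in 𝓝[≠] (0 : ℝ), ‖δ * ⟪v δ, (hVmem f).toLp _⟫_ℝ‖ ≤
          |δ| * (Real.sqrt C * ‖(hVmem f).toLp _‖) := by
        filter_upwards [hb] with δ hδ
        rw [norm_mul, Real.norm_eq_abs, Real.norm_eq_abs]
        refine mul_le_mul_of_nonneg_left ?_ (abs_nonneg _)
        exact (abs_real_inner_le_norm _ _).trans (mul_le_mul_of_nonneg_right hδ (norm_nonneg _))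
      refine squeeze_zero_norm' hbd ?_
      have h0 : Tendsto (fun δ : ℝ => |δ| * (Real.sqrt C * ‖(hVmem f).toLp (V f.1)‖)) (𝓝 0)
          (𝓝 (|0| * (Real.sqrt C * ‖(hVmem f).toLp (V f.1)‖))) :=
        ((continuous_abs.tendsto (0 : ℝ)).mul tendsto_const_nhds)
      rw [abs_zero, zero_mul] at h0
      exact h0.mono_left nhdsWithin_le_nhds
    have hlim : Tendsto (fun δ : ℝ => -∫ x, V f.1 x ∂π - δ * ⟪v δ, (hVmem f).toLp _⟫_ℝ) (𝓝[≠] 0)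
        (𝓝 (-∫ x, V f.1 x ∂π - 0)) := tendsto_const_nhds.sub hsmall
    rw [sub_zero] at hlim
    exact hlim.congr' (hid.mono fun δ h => h.symm)
  -- mean zero: moments against `1`
  have hmean : ∀ᶠ δ in 𝓝[≠] (0 : ℝ), ⟪v δ, h1mem.toLp _⟫_ℝ = 0 := by
    filter_upwards [hev] with δ ⟨hne, ⟨h1, h2⟩, _, hrep⟩
    haveI : IsProbabilityMeasure (μ (T + δ / 2) (T - δ / 2)) := (hμ _ _ h1 h2).1.1
    obtain ⟨_, hone⟩ := hrep _ h1mem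
    simp only [integral_const, smul_eq_mul, mul_one, one_mul, probReal_univ] at hone
    rw [hv_inner]
    simp only [mul_one]
    have : δ * ∫ x, k δ x ∂π = 0 := by linarith
    rcases mul_eq_zero.1 this with h | h
    · exact absurd h hne
    · exact h
  have hconv : ∀ j, Tendsto (fun δ => ⟪v δ, e j⟫_ℝ) (𝓝[≠] 0) (𝓝 (c j)) := by
    rintro (_ | f)
    · exact tendsto_const_nhds.congr' (hmean.mono fun δ h => h.symm)
    · exact hmom f
  -- (U): uniqueness of the limiting equations in `L²(π)`
  have huniq : ∀ u u' : Lp ℝ 2 π, (∀ j, ⟪u, e j⟫_ℝ = c j) → (∀ j, ⟪u', e j⟫_ℝ = c j) → u = u' := by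
    intro u u' hu hu'
    rw [← sub_eq_zero]
    have hw : ∀ j, ⟪u - u', e j⟫_ℝ = 0 := fun j => by
      rw [inner_sub_left, hu, hu', sub_self]
    have hw0 : ((u - u' : Lp ℝ 2 π) : PhaseSpace N → ℝ) =ᵐ[π] 0 := by
      refine hU _ (Lp.memLp _) ?_ ?_
      · have h := hw none
        rw [show e none = h1mem.toLp _ from rfl, inner_toLp_eq_integral] at h
        simpa only [mul_one] using h
      · intro f hf hfc
        have h := hw (some ⟨f, hf, hfc⟩)
        rw [show e (some ⟨f, hf, hfc⟩) = (hLmem ⟨f, hf, hfc⟩).toLp _ from rfl,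
          inner_toLp_eq_integral] at h
        rw [← h]
        exact integral_congr_ae (Eventually.of_forall fun x => mul_comm _ _)
    exact Lp.eq_zero_iff_ae_eq_zero.2 hw0
  -- weak convergence of the whole net
  obtain ⟨u, -, -, hweak⟩ := exists_tendsto_inner_of_norm_le v hb e c hconv huniq
  -- difference quotients of `L²` observables
  have hslope : ∀ F : PhaseSpace N → ℝ, MemLp F 2 π →
      Tendsto (fun δ : ℝ => ((∫ x, F x ∂(μ (T + δ / 2) (T - δ / 2))) - ∫ x, F x ∂π) / δ)
        (𝓝[≠] 0) (𝓝 (∫ x, F x * u x ∂π)) := by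
    intro F hFm
    have hl := hweak (hFm.toLp F)
    rw [inner_toLp_eq_integral] at hl
    have e1 : ∫ x, u x * F x ∂π = ∫ x, F x * u x ∂π :=
      integral_congr_ae (Eventually.of_forall fun x => mul_comm _ _)
    rw [e1] at hl
    refine hl.congr' ?_
    filter_upwards [hev] with δ ⟨hne, _, _, hrep⟩
    obtain ⟨_, hF⟩ := hrep F hFm
    rw [hv_inner, hF, add_sub_cancel_left, mul_div_cancel_left₀ _ hne]
    exact integral_congr_ae (Eventually.of_forall fun x => mul_comm (k δ x) (F x))
  -- conclusion
  refine StubResponseDensityDet.of_tendsto_slope P μ hπμ (u : PhaseSpace N → ℝ) ?_ ?_ ?_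
  · rw [hπμ]
    exact Lp.memLp u
  · intro F hF hFc
    rw [hπμ]
    exact hslope F (memLp_of_continuous_hasCompactSupport hF.continuous hFc π 2)
  · intro i
    rw [hπμ]
    exact hslope _ (memLp_bondCurrent_gibbsMeasure hω hl hβ γ N hT i)

/-! ### Registered helper sub-goal (stub form, one line) -/

/-- Registered helper sub-goal `helper_responseDensityNoisyOfAprioriOfUnique` of stub
`stub_responseDensityNoisy` (= `of_apriori_of_unique` in stub form): the stub's conclusion, for every
length and every rate, from (A) an a priori `L²(μ_T)` linear-response bound of the flip steady family and
(U) `L²(μ_T)`-uniqueness of the linearised flip-noisy equation. -/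
theorem helper_responseDensityNoisyOfAprioriOfUnique : ∀ ω₂ lam β γ : ℝ, 0 < ω₂ → 0 ≤ lam → 0 ≤ β → ∀ (N : ℕ) (T : ℝ), 0 < T → ∀ (ε : ℝ) (μ : ℝ → ℝ → MeasureTheory.Measure (Literature.MathematicalPhysics.KineticTheory.HeatConduction.PhaseSpace N)), (∀ T_L T_R : ℝ, 0 < T_L → 0 < T_R → (Literature.MathematicalPhysics.KineticTheory.HeatConduction.pinnedChain ω₂ lam β γ).IsFlipSteadyState N T_L T_R ε (μ T_L T_R) ∧ ∀ ν : MeasureTheory.Measure (Literature.MathematicalPhysics.KineticTheory.HeatConduction.PhaseSpace N), (Literature.MathematicalPhysics.KineticTheory.HeatConduction.pinnedChain ω₂ lam β γ).IsFlipSteadyState N T_L T_R ε ν → ν = μ T_L T_R) → (∃ C : ℝ, ∀ᶠ δ in nhdsWithin (0 : ℝ) {(0 : ℝ)}ᶜ, ∃ k : Literature.MathematicalPhysics.KineticTheory.HeatConduction.PhaseSpace N → ℝ, MeasureTheory.MemLp k 2 ((Literature.MathematicalPhysics.KineticTheory.HeatConduction.pinnedChain ω₂ lam β γ).gibbsMeasure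 N T) ∧ ∫ x, k x ^ 2 ∂((Literature.MathematicalPhysics.KineticTheory.HeatConduction.pinnedChain ω₂ lam β γ).gibbsMeasure N T) ≤ C ∧ ∀ F : Literature.MathematicalPhysics.KineticTheory.HeatConduction.PhaseSpace N → ℝ, MeasureTheory.MemLp F 2 ((Literature.MathematicalPhysics.KineticTheory.HeatConduction.pinnedChain ω₂ lam β γ).gibbsMeasure N T) → MeasureTheory.Integrable F (μ (T + δ / 2) (T - δ / 2)) ∧ ∫ x, F x ∂(μ (T + δ / 2) (T - δ / 2)) = ∫ x, F x ∂((Literature.MathematicalPhysics.KineticTheory.HeatConduction.pinnedChain ω₂ lam β γ).gibbsMeasure N T) + δ * ∫ x, F x * k x ∂((Literature.MathematicalPhysics.KineticTheory.HeatConduction.pinnedChain ω₂ lam β γ).gibbsMeasure N T)) → (∀ k : Literature.MathematicalPhysics.KineticTheory.HeatConduction.PhaseSpace N → ℝ, MeasureTheory.MemLp k 2 ((Literature.MathematicalPhysics.KineticTheory.HeatConduction.pinnedChain ω₂ lam β γ).gibbsMeasure N T) → ∫ x, k x ∂((Literature.MathematicalPhysics.KineticTheory.HeatConduction.pinnedChain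 ω₂ lam β γ).gibbsMeasure N T) = 0 → (∀ f : Literature.MathematicalPhysics.KineticTheory.HeatConduction.PhaseSpace N → ℝ, ContDiff ℝ ((⊤ : ℕ∞) : WithTop ℕ∞) f → HasCompactSupport f → ∫ x, (Literature.MathematicalPhysics.KineticTheory.HeatConduction.pinnedChain ω₂ lam β γ).flipGenerator N T T ε f x * k x ∂((Literature.MathematicalPhysics.KineticTheory.HeatConduction.pinnedChain ω₂ lam β γ).gibbsMeasure N T) = 0) → Filter.EventuallyEq (MeasureTheory.ae ((Literature.MathematicalPhysics.KineticTheory.HeatConduction.pinnedChain ω₂ lam β γ).gibbsMeasure N T)) k 0) → ∃ U : Literature.MathematicalPhysics.KineticTheory.HeatConduction.PhaseSpace N → ℝ, MeasureTheory.MemLp U 2 ((Literature.MathematicalPhysics.KineticTheory.HeatConduction.pinnedChain ω₂ lam β γ).gibbsMeasure N T) ∧ (∀ g : Literature.MathematicalPhysics.KineticTheory.HeatConduction.PhaseSpace N → ℝ, ContDiff ℝ ((⊤ : ℕ∞) : WithTop ℕ∞) g → HasCompactSupport g → HasDerivAt (fun δ : ℝ => ∫ x, g x ∂(μ (T + δ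 / 2) (T - δ / 2))) (∫ x, g x * U x ∂((Literature.MathematicalPhysics.KineticTheory.HeatConduction.pinnedChain ω₂ lam β γ).gibbsMeasure N T)) 0) ∧ HasDerivAt (fun δ : ℝ => (Literature.MathematicalPhysics.KineticTheory.HeatConduction.pinnedChain ω₂ lam β γ).totalCurrent (μ (T + δ / 2) (T - δ / 2))) (∑ i : Fin N, ∫ x, (Literature.MathematicalPhysics.KineticTheory.HeatConduction.pinnedChain ω₂ lam β γ).bondCurrent N i x * U x ∂((Literature.MathematicalPhysics.KineticTheory.HeatConduction.pinnedChain ω₂ lam β γ).gibbsMeasure N T)) 0 :=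
  fun _ _ _ γ hω hl hβ N _ hT ε μ hμ hA hU => of_apriori_of_unique hω hl hβ γ N hT ε μ hμ hA hU

end Summit.AtomisticToContinuum.FouriersLaw.Theorems.NoiseLocality.StubResponseDensityNoisy

end
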